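import Literature.Barriers.AtomisticToContinuum.DisorderedHarmonicChainPhaseCalculus
import Literature.Barriers.AtomisticToContinuum.DisorderedHarmonicChainRestart
import HarnessLib

/-!
# Ajanki–Huveneers 2011: first variations of the phase chain along one reduced mass

Fifth file of the integration-by-parts route to the low-frequency upper bound (U) of
`…Transfer.lean` (O. Ajanki, F. Huveneers, CMP **301** (2011) 841–883, arXiv:1003.1076; §5 of
the paper obtains the density bound of Prop. 5.1 by a parametrix, we integrate by parts on the
disorder). This file is pure calculus on the lifted chain `X_j = ahPhase w x B j`:

* the objects `P_i = P(X_i, δ(B_i))` (`vaP`, the inverse Jacobian of the step, `= ahFactor²`), the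
  derivative cocycle `J_j = ∏_{i<j} P_i⁻¹` (`vaJ`), `u_k = 1 - cos 2πX_k` (`vaU`), the partial sums
  `N_j = ∑_{k<j} ξ(B_k) u_k` (`vaN`) and the predictable weights `a_k = πJ_k/c(w)` (`vaA`);
* the section derivatives in one coordinate `B_k` — of `X_j` (`vaDX`, PROVED:
  `hasDerivAt_ahPhase_update`), of `u_j`, `P_j`, `J_j`, `N_j` (`vaDU`, `vaDP`, `vaDJ`, `vaDN`,
  with their `HasDerivAt` statements) — all defined by the obvious recursions/sums and using only
  `∂_x f_b = 1/P`, `∂_b f_b = c(w)(1 - cos 2πx)/(πP)` of `…PhaseCalculus.lean`;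
* **the normalisation identity** `a_k · ∂_k X_j = u_k J_j` (`k < j`) (`vaA_mul_vaDX`): along the
  vector field `V = ∑_k a_k ξ(B_k) ∂_k` the first variation of the phase is EXACTLY
  `V X_j = J_j N_j` (`sum_vaW_mul_vaDX`), and the companion identities for `V N_j` and
  `V log J_m` (`sum_vaW_mul_vaDN`, `sum_vaW_mul_vaDJ`);
* elementary bounds (`1/2 ≤ P ≤ 2`, `2^{-j} ≤ J_j ≤ 2^j`, `0 ≤ u ≤ 2`, continuity in the varied
  coordinate) and the locality of all objects in the coordinates (`…_update_of_le`).

[cite: AjankiHuveneers2011, Lemma 3.2 eq. (3.10), Def. 3.3, Prop. 3.5 eq. (3.14) (the cocycle is `Γ⁻²` up to the first factor)]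
-/

noncomputable section

open Real Finset Function

namespace Literature.Barriers.AtomisticToContinuum.HeatConduction

/-! ### The objects -/

section Defs

variable (w x : ℝ) (B : ℕ → ℝ)

/-- `P_i = P(X_i, δ(w, B_i))`, the inverse Jacobian of the `i`-th step (`= ahFactor(X_i,B_i)²`).
[cite: AjankiHuveneers2011, Prop. 3.5 eq. (3.19); App. 7.1] -/
def vaP (i : ℕ) : ℝ := pcP (ahPhase w x B i) (igDelta w (B i))

/-- The derivative cocycle `J_j = ∏_{i<j} P_i⁻¹ = ∂X_j/∂X_0`. [cite: AjankiHuveneers2011, Prop. 3.5 eq. (3.14)] -/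
def vaJ (j : ℕ) : ℝ := ∏ i ∈ Finset.range j, (vaP w x B i)⁻¹

/-- `u_k = 1 - cos 2πX_k = 2 sin² πX_k`. [cite: AjankiHuveneers2011, Lemma 3.2 eq. (3.11) (`φ = sin²π·`)] -/
def vaU (k : ℕ) : ℝ := 1 - Real.cos (2 * π * ahPhase w x B k)

/-- `N_j = ∑_{k<j} ξ(B_k) u_k`. [folklore] -/
def vaN (ξ : ℝ → ℝ) (j : ℕ) : ℝ := ∑ k ∈ Finset.range j, ξ (B k) * vaU w x B k

/-- The predictable weight `a_k = π J_k / c(w)` of the smoothing vector field. [folklore] -/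
def vaA (k : ℕ) : ℝ := π * vaJ w x B k / igC w

/-- The full coefficient `a_k ξ(B_k)` of `∂_k` in the vector field `V`. [folklore] -/
def vaW (ξ : ℝ → ℝ) (k : ℕ) : ℝ := vaA w x B k * ξ (B k)

/-- `∂X_j/∂B_k` (recursion in `j`: `0` for `j ≤ k`, `c(w)u_k/(πP_k)` at `j = k+1`, then divided by
`P_j` at each further step). [cite: AjankiHuveneers2011, Lemma 3.2 eqs. (3.8), (3.10)] -/
def vaDX (k : ℕ) : ℕ → ℝ
  | 0 => 0
  | j + 1 => if j < k then 0
      else if j = k then igC w * vaU w x B k / (π * vaP w x B k)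
      else vaDX k j / vaP w x B j

/-- `∂u_j/∂B_k = 2π sin(2πX_j) ∂X_j/∂B_k`. [folklore] -/
def vaDU (k j : ℕ) : ℝ := 2 * π * Real.sin (2 * π * ahPhase w x B j) * vaDX w x B k j

/-- `∂P_j/∂B_k = P_x(X_j,δ_j) ∂X_j/∂B_k + P_δ(X_j,δ_j) c(w) [j = k]`. [folklore] -/
def vaDP (k j : ℕ) : ℝ :=
  pcPx (ahPhase w x B j) (igDelta w (B j)) * vaDX w x B k j +
    (if j = k then pcPd (ahPhase w x B j) (igDelta w (B j)) * igC w else 0)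

/-- `∂J_j/∂B_k` (recursion: `J_{j+1} = J_j P_j⁻¹`). [folklore] -/
def vaDJ (k : ℕ) : ℕ → ℝ
  | 0 => 0
  | j + 1 => vaDJ k j * (vaP w x B j)⁻¹ + vaJ w x B j * (-(vaDP w x B k j) / vaP w x B j ^ 2)

/-- `∂N_j/∂B_k = [k<j] ξ'(B_k) u_k + ∑_{i<j} ξ(B_i) ∂u_i/∂B_k`. [folklore] -/
def vaDN (ξ : ℝ → ℝ) (k j : ℕ) : ℝ :=
  ∑ i ∈ Finset.range j, ((if i = k then deriv ξ (B i) * vaU w x B i else 0) + ξ (B i) * vaDU w x B k i)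

end Defs

/-! ### Locality in the coordinates -/

section Locality

variable (w x : ℝ)

/-- `X_j(B[k ↦ t]) = X_j(B)` for `j ≤ k`. [folklore] -/
theorem ahPhase_update_of_le (B : ℕ → ℝ) {k j : ℕ} (hjk : j ≤ k) (t : ℝ) :
    ahPhase w x (update B k t) j = ahPhase w x B j :=
  ahPhase_congr w x j fun i hi => by
    rw [update_of_ne (by omega)]

/-- `P_i(B[k ↦ t]) = P_i(B)` for `i < k`. [folklore] -/
theorem vaP_update_of_lt (B : ℕ → ℝ) {k i : ℕ} (hik : i < k) (t : ℝ) :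
    vaP w x (update B k t) i = vaP w x B i := by
  unfold vaP
  rw [ahPhase_update_of_le w x B hik.le, update_of_ne (by omega)]

/-- `J_j(B[k ↦ t]) = J_j(B)` for `j ≤ k`. [folklore] -/
theorem vaJ_update_of_le (B : ℕ → ℝ) {k j : ℕ} (hjk : j ≤ k) (t : ℝ) :
    vaJ w x (update B k t) j = vaJ w x B j := by
  unfold vaJ
  refine Finset.prod_congr rfl fun i hi => ?_
  rw [vaP_update_of_lt w x B (by have := Finset.mem_range.mp hi; omega)]

/-- `u_j(B[k ↦ t]) = u_j(B)` for `j ≤ k`. [folklore] -/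
theorem vaU_update_of_le (B : ℕ → ℝ) {k j : ℕ} (hjk : j ≤ k) (t : ℝ) :
    vaU w x (update B k t) j = vaU w x B j := by
  unfold vaU
  rw [ahPhase_update_of_le w x B hjk]

/-- `a_j(B[k ↦ t]) = a_j(B)` for `j ≤ k`: the weights are predictable. [folklore] -/
theorem vaA_update_of_le (B : ℕ → ℝ) {k j : ℕ} (hjk : j ≤ k) (t : ℝ) :
    vaA w x (update B k t) j = vaA w x B j := by
  unfold vaA
  rw [vaJ_update_of_le w x B hjk]

/-- `N_j(B[k ↦ t]) = N_j(B)` for `j ≤ k`. [folklore] -/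
theorem vaN_update_of_le (ξ : ℝ → ℝ) (B : ℕ → ℝ) {k j : ℕ} (hjk : j ≤ k) (t : ℝ) :
    vaN w x (update B k t) ξ j = vaN w x B ξ j := by
  unfold vaN
  refine Finset.sum_congr rfl fun i hi => ?_
  have hi' : i < j := Finset.mem_range.mp hi
  rw [vaU_update_of_le w x B (by omega), update_of_ne (by omega)]

/-- `∂X_j/∂B_k = 0` for `j ≤ k`. [folklore] -/
theorem vaDX_of_le (B : ℕ → ℝ) {k j : ℕ} (hjk : j ≤ k) : vaDX w x B k j = 0 := by
  cases j with
  | zero => rfl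
  | succ j => simp [vaDX, show j < k by omega]

end Locality

/-! ### Positivity and elementary bounds -/

section Bounds

variable {w x M : ℝ} {B : ℕ → ℝ}

/-- `P_i > 0`. [folklore] -/
theorem vaP_pos (w x : ℝ) (B : ℕ → ℝ) (i : ℕ) : 0 < vaP w x B i := pcP_pos _ _

/-- `J_j > 0`. [folklore] -/
theorem vaJ_pos (w x : ℝ) (B : ℕ → ℝ) (j : ℕ) : 0 < vaJ w x B j :=
  Finset.prod_pos fun i _ => inv_pos.mpr (vaP_pos w x B i)

/-- `J_{j+1} = J_j P_j⁻¹`. [folklore] -/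
theorem vaJ_succ (w x : ℝ) (B : ℕ → ℝ) (j : ℕ) : vaJ w x B (j + 1) = vaJ w x B j * (vaP w x B j)⁻¹ := by
  unfold vaJ; rw [Finset.prod_range_succ]

/-- `J_0 = 1`. [folklore] -/
@[simp] theorem vaJ_zero (w x : ℝ) (B : ℕ → ℝ) : vaJ w x B 0 = 1 := by simp [vaJ]

/-- `0 ≤ u_k ≤ 2`. [folklore] -/
theorem vaU_bounds (w x : ℝ) (B : ℕ → ℝ) (k : ℕ) : 0 ≤ vaU w x B k ∧ vaU w x B k ≤ 2 := by
  unfold vaU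
  constructor
  · linarith [Real.cos_le_one (2 * π * ahPhase w x B k)]
  · linarith [Real.neg_one_le_cos (2 * π * ahPhase w x B k)]

/-- `u_k = 2 sin²(πX_k)`. [folklore] -/
theorem vaU_eq_sin_sq (w x : ℝ) (B : ℕ → ℝ) (k : ℕ) :
    vaU w x B k = 2 * Real.sin (π * ahPhase w x B k) ^ 2 := by
  unfold vaU
  rw [show 2 * π * ahPhase w x B k = 2 * (π * ahPhase w x B k) by ring, Real.cos_two_mul, Real.cos_sq']
  ring

/-- In the small regime, `1/2 ≤ P_i ≤ 2`. [folklore] -/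
theorem vaP_bounds (hM : 0 ≤ M) (hw0 : 0 ≤ w) (hw : w ≤ pcW M) (hB : ∀ i, |B i| ≤ M) (i : ℕ) :
    1 / 2 ≤ vaP w x B i ∧ vaP w x B i ≤ 2 := by
  obtain ⟨-, -, hδ⟩ := pc_small hM hw0 hw (hB i)
  exact pcP_bounds (by linarith) _

/-- In the small regime, `2^{-j} ≤ J_j ≤ 2^j`. [folklore] -/
theorem vaJ_bounds (hM : 0 ≤ M) (hw0 : 0 ≤ w) (hw : w ≤ pcW M) (hB : ∀ i, |B i| ≤ M) :
    ∀ j, (1 / 2) ^ j ≤ vaJ w x B j ∧ vaJ w x B j ≤ 2 ^ j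
  | 0 => by simp
  | j + 1 => by
    obtain ⟨ih1, ih2⟩ := vaJ_bounds hM hw0 hw hB j
    obtain ⟨hP1, hP2⟩ := vaP_bounds (x := x) hM hw0 hw hB j
    have hPpos := vaP_pos w x B j
    rw [vaJ_succ]
    constructor
    · rw [pow_succ]
      have : (1 / 2 : ℝ) ≤ (vaP w x B j)⁻¹ := by
        rw [le_inv_comm₀ (by norm_num) hPpos]; norm_num; exact hP2
      exact mul_le_mul ih1 this (by norm_num) (vaJ_pos w x B j).le
    · rw [pow_succ]
      have : (vaP w x B j)⁻¹ ≤ 2 := by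
        rw [inv_le_comm₀ hPpos (by norm_num)]; linarith
      exact mul_le_mul ih2 this (inv_pos.mpr hPpos).le (by positivity)

/-- `c(w) > 0` for `0 < w`, `πw/2 < 1`. [folklore] -/
theorem igC_pos {w : ℝ} (hw0 : 0 < w) (hw : π * w / 2 < 1) : 0 < igC w := by
  unfold igC; exact div_pos (by positivity) (igQ0_pos hw0.le hw)

/-- `a_k > 0`. [folklore] -/
theorem vaA_pos (hw0 : 0 < w) (hw : π * w / 2 < 1) (k : ℕ) : 0 < vaA w x B k := by
  unfold vaA; exact div_pos (mul_pos Real.pi_pos (vaJ_pos w x B k)) (igC_pos hw0 hw)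

end Bounds

/-! ### The normalisation identity `a_k ∂_k X_j = u_k J_j` -/

section Normalisation

variable {w x : ℝ} (B : ℕ → ℝ)

/-- **`a_k · ∂X_j/∂B_k = u_k J_j` for `k < j`** (and `0` otherwise): the weight `a_k = πJ_k/c(w)`
cancels the factor `c(w)/(πP_k)` of `∂_b f_b` and completes the product of the `P_i⁻¹`.
[cite: AjankiHuveneers2011, Lemma 3.2 eqs. (3.8), (3.10)-(3.11) (structure of `∂_b f_b`)] -/
theorem vaA_mul_vaDX (hw0 : 0 < w) (hw : π * w / 2 < 1) (k : ℕ) :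
    ∀ j, vaA w x B k * vaDX w x B k j = if k < j then vaU w x B k * vaJ w x B j else 0
  | 0 => by simp [vaDX]
  | j + 1 => by
    have hc := (igC_pos hw0 hw).ne'
    have hπ := Real.pi_pos.ne'
    rcases lt_trichotomy j k with hjk | rfl | hjk
    · simp [vaDX, hjk, show ¬ (k < j + 1) by omega]
    · simp only [vaDX, lt_irrefl, ↓reduceIte, show j < j + 1 by omega]
      unfold vaA
      rw [vaJ_succ]
      have hP := (vaP_pos w x B j).ne'
      field_simp
    · have ih := vaA_mul_vaDX hw0 hw k j
      simp only [show k < j by omega, ↓reduceIte] at ih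
      simp only [vaDX, show ¬ (j < k) by omega, show j ≠ k by omega, ↓reduceIte, show k < j + 1 by omega]
      rw [mul_div_assoc', ih, vaJ_succ]
      have hP := (vaP_pos w x B j).ne'
      field_simp

/-- `∂X_j/∂B_k ≥ 0`. [folklore] -/
theorem vaDX_nonneg (hw0 : 0 < w) (hw : π * w / 2 < 1) (k j : ℕ) : 0 ≤ vaDX w x B k j := by
  have h := vaA_mul_vaDX (x := x) B hw0 hw k j
  have ha := vaA_pos (x := x) (B := B) hw0 hw k
  have hr : 0 ≤ vaA w x B k * vaDX w x B k j := by
    rw [h]; split_ifs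
    · exact mul_nonneg (vaU_bounds w x B k).1 (vaJ_pos w x B j).le
    · exact le_rfl
  exact (mul_nonneg_iff_of_pos_left ha).mp hr

/-- **`V X_j = J_j N_j`**: `∑_{k<m} a_k ξ(B_k) ∂X_j/∂B_k = J_j N_j` for `j ≤ m`. [folklore] -/
theorem sum_vaW_mul_vaDX (hw0 : 0 < w) (hw : π * w / 2 < 1) (ξ : ℝ → ℝ) {m j : ℕ} (hjm : j ≤ m) :
    ∑ k ∈ Finset.range m, vaW w x B ξ k * vaDX w x B k j = vaJ w x B j * vaN w x B ξ j := by
  have h : ∀ k, vaW w x B ξ k * vaDX w x B k j =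
      if k < j then ξ (B k) * vaU w x B k * vaJ w x B j else 0 := by
    intro k
    unfold vaW
    rw [mul_right_comm, vaA_mul_vaDX B hw0 hw k j]
    split_ifs <;> ring
  simp only [h]
  rw [← Finset.sum_filter, show (Finset.range m).filter (fun k => k < j) = Finset.range j from ?_]
  · unfold vaN
    rw [Finset.mul_sum]
    refine Finset.sum_congr rfl fun k _ => by ring
  · ext k; simp only [Finset.mem_filter, Finset.mem_range]; omega

/-- **`V N_j`**: `∑_{k<m} a_kξ(B_k) ∂N_j/∂B_k = ∑_{k<j} a_kξ(B_k)ξ'(B_k)u_k + ∑_{i<j} ξ(B_i) 2π sin(2πX_i) J_i N_i`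
for `j ≤ m`. [folklore] -/
theorem sum_vaW_mul_vaDN (hw0 : 0 < w) (hw : π * w / 2 < 1) (ξ : ℝ → ℝ) {m j : ℕ} (hjm : j ≤ m) :
    ∑ k ∈ Finset.range m, vaW w x B ξ k * vaDN w x B ξ k j =
      ∑ k ∈ Finset.range j, vaW w x B ξ k * (deriv ξ (B k) * vaU w x B k) +
        ∑ i ∈ Finset.range j, ξ (B i) * (2 * π * Real.sin (2 * π * ahPhase w x B i)) *
          (vaJ w x B i * vaN w x B ξ i) := by
  unfold vaDN
  simp only [Finset.mul_sum, mul_add]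
  rw [Finset.sum_comm]
  simp only [Finset.sum_add_distrib]
  congr 1
  · -- the diagonal term
    refine Finset.sum_congr rfl fun i hi => ?_
    have hi' : i < j := Finset.mem_range.mp hi
    simp only [mul_ite, mul_zero]
    rw [Finset.sum_ite_eq (Finset.range m) i, if_pos (Finset.mem_range.mpr (by omega))]
  · refine Finset.sum_congr rfl fun i hi => ?_
    have hi' : i < j := Finset.mem_range.mp hi
    unfold vaDU
    have h := sum_vaW_mul_vaDX (x := x) B hw0 hw ξ (show i ≤ m by omega)
    calc ∑ k ∈ Finset.range m, vaW w x B ξ k *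
          (ξ (B i) * (2 * π * Real.sin (2 * π * ahPhase w x B i) * vaDX w x B k i))
        = ξ (B i) * (2 * π * Real.sin (2 * π * ahPhase w x B i)) *
            ∑ k ∈ Finset.range m, vaW w x B ξ k * vaDX w x B k i := by
          rw [Finset.mul_sum]; refine Finset.sum_congr rfl fun k _ => by ring
      _ = _ := by rw [h]

/-- **`V P_i`**: `∑_{k<m} a_kξ(B_k) ∂P_i/∂B_k = P_x(X_i,δ_i) J_i N_i + [i<m] P_δ(X_i,δ_i) π J_i ξ(B_i)`
for `i ≤ m`. [folklore] -/
theorem sum_vaW_mul_vaDP (hw0 : 0 < w) (hw : π * w / 2 < 1) (ξ : ℝ → ℝ) {m i : ℕ} (him : i ≤ m) :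
    ∑ k ∈ Finset.range m, vaW w x B ξ k * vaDP w x B k i =
      pcPx (ahPhase w x B i) (igDelta w (B i)) * (vaJ w x B i * vaN w x B ξ i) +
        (if i < m then pcPd (ahPhase w x B i) (igDelta w (B i)) * (π * vaJ w x B i) * ξ (B i) else 0) := by
  unfold vaDP
  simp only [mul_add, Finset.sum_add_distrib]
  congr 1
  · rw [← sum_vaW_mul_vaDX (x := x) B hw0 hw ξ him, Finset.mul_sum]
    refine Finset.sum_congr rfl fun k _ => by ring
  · have hc := (igC_pos hw0 hw).ne'
    simp only [mul_ite, mul_zero]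
    rw [Finset.sum_ite_eq (Finset.range m) i]
    simp only [Finset.mem_range]
    split_ifs with h
    · unfold vaW vaA; field_simp
    · rfl

/-- Closed form of `∂J_j/∂B_k`: `∂J_j/∂B_k = -J_j ∑_{i<j} (∂P_i/∂B_k)/P_i`. [folklore] -/
theorem vaDJ_eq (k : ℕ) : ∀ j, vaDJ w x B k j =
    -(vaJ w x B j * ∑ i ∈ Finset.range j, vaDP w x B k i / vaP w x B i)
  | 0 => by simp [vaDJ]
  | j + 1 => by
    rw [vaDJ, vaDJ_eq k j, Finset.sum_range_succ, vaJ_succ]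
    have hP := (vaP_pos w x B j).ne'
    field_simp
    ring

/-- **`V log J_m`**: `∑_{k<m} a_kξ(B_k) (∂J_m/∂B_k)/J_m = -∑_{i<m} [P_x,i J_iN_i + P_δ,i πJ_iξ(B_i)]/P_i`.
[folklore] -/
theorem sum_vaW_mul_vaDJ (hw0 : 0 < w) (hw : π * w / 2 < 1) (ξ : ℝ → ℝ) (m : ℕ) :
    ∑ k ∈ Finset.range m, vaW w x B ξ k * (vaDJ w x B k m / vaJ w x B m) =
      -∑ i ∈ Finset.range m, (pcPx (ahPhase w x B i) (igDelta w (B i)) * (vaJ w x B i * vaN w x B ξ i) +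
          pcPd (ahPhase w x B i) (igDelta w (B i)) * (π * vaJ w x B i) * ξ (B i)) / vaP w x B i := by
  have hJ := (vaJ_pos w x B m).ne'
  have h1 : ∀ k, vaDJ w x B k m / vaJ w x B m = -∑ i ∈ Finset.range m, vaDP w x B k i / vaP w x B i := by
    intro k; rw [vaDJ_eq]; field_simp
  simp only [h1, mul_neg, Finset.sum_neg_distrib, Finset.mul_sum]
  rw [Finset.sum_comm, neg_inj]
  refine Finset.sum_congr rfl fun i hi => ?_
  have hi' : i < m := Finset.mem_range.mp hi
  have h := sum_vaW_mul_vaDP (x := x) B hw0 hw ξ hi'.le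
  simp only [hi', ↓reduceIte] at h
  calc ∑ k ∈ Finset.range m, vaW w x B ξ k * (vaDP w x B k i / vaP w x B i)
      = (∑ k ∈ Finset.range m, vaW w x B ξ k * vaDP w x B k i) / vaP w x B i := by
        rw [Finset.sum_div]
        exact Finset.sum_congr rfl fun k _ => by ring
    _ = _ := by rw [h]

end Normalisation

/-! ### The section derivatives -/

section Derivatives

variable {w x M : ℝ}

/-- **`∂X_j/∂B_k` is the derivative of the section** `t ↦ X_j(B[k ↦ t])` at `t = B_k`, in the
small regime (`0 < w ≤ w_pc(M)`, `|B_i| ≤ M`). [cite: AjankiHuveneers2011, Lemma 3.2 eqs. (3.8), (3.10)] -/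
theorem hasDerivAt_ahPhase_update (hM : 0 ≤ M) (hw0 : 0 < w) (hw : w ≤ pcW M) (B : ℕ → ℝ)
    (hB : ∀ i, |B i| ≤ M) (k : ℕ) :
    ∀ j, HasDerivAt (fun t => ahPhase w x (update B k t) j) (vaDX w x B k j) (B k)
  | 0 => by simpa [vaDX] using hasDerivAt_const (B k) x
  | j + 1 => by
    obtain ⟨hw2, -, -⟩ := pc_small hM hw0.le hw (hB 0)
    have hw1 : π * w / 2 < 1 := by linarith
    rcases lt_trichotomy j k with hjk | rfl | hjk
    · -- `X_{j+1}` does not depend on `B_k`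
      have hconst : (fun t => ahPhase w x (update B k t) (j + 1)) = fun _ => ahPhase w x B (j + 1) :=
        funext fun t => ahPhase_update_of_le w x B (by omega) t
      rw [hconst]
      simpa [vaDX, hjk] using hasDerivAt_const (B k) (ahPhase w x B (j + 1))
    · -- `X_{k+1} = f_{B_k}(X_k)` with `X_k` independent of `B_k`
      have hfun : (fun t => ahPhase w x (update B j t) (j + 1)) = fun t => ahStep w t (ahPhase w x B j) := by
        funext t
        rw [ahPhase_succ, update_self, ahPhase_update_of_le w x B le_rfl]
      rw [hfun]
      obtain ⟨-, -, hδ⟩ := pc_small hM hw0.le hw (hB j)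
      have h := hasDerivAt_ahStep_b (x := ahPhase w x B j) hw0.le hw1 (by linarith : |igDelta w (B j)| < 1)
      refine h.congr_deriv ?_
      simp only [vaDX, lt_irrefl, ↓reduceIte]
      unfold vaU vaP
      ring
    · -- chain rule through `X_j`
      have ih := hasDerivAt_ahPhase_update hM hw0 hw B hB k j
      have hfun : (fun t => ahPhase w x (update B k t) (j + 1)) =
          fun t => ahStep w (B j) (ahPhase w x (update B k t) j) := by
        funext t
        rw [ahPhase_succ, update_of_ne (by omega)]
      rw [hfun]
      obtain ⟨-, -, hδ⟩ := pc_small hM hw0.le hw (hB j)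
      have hout := hasDerivAt_ahStep_x (b := B j) hw0.le hw1 (by linarith : |igDelta w (B j)| < 1)
        (ahPhase w x (update B k (B k)) j)
      have hcomp := hout.comp (B k) ih
      rw [update_eq_self] at hcomp
      refine hcomp.congr_deriv ?_
      simp only [vaDX, show ¬ (j < k) by omega, show j ≠ k by omega, ↓reduceIte]
      unfold vaP
      ring

/-- The same at an arbitrary value of the varied coordinate. [folklore] -/
theorem hasDerivAt_ahPhase_update' (hM : 0 ≤ M) (hw0 : 0 < w) (hw : w ≤ pcW M) (B : ℕ → ℝ)
    (hB : ∀ i, |B i| ≤ M) (k : ℕ) {t : ℝ} (ht : |t| ≤ M) (j : ℕ) :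
    HasDerivAt (fun s => ahPhase w x (update B k s) j) (vaDX w x (update B k t) k j) t := by
  have hB' : ∀ i, |update B k t i| ≤ M := fun i => by
    rcases eq_or_ne i k with rfl | h
    · rwa [update_self]
    · rw [update_of_ne h]; exact hB i
  have h := hasDerivAt_ahPhase_update (x := x) hM hw0 hw (update B k t) hB' k j
  simp only [update_idem, update_self] at h
  exact h

/-- `∂u_j/∂B_k` is the derivative of the section of `u_j`. [folklore] -/
theorem hasDerivAt_vaU_update (hM : 0 ≤ M) (hw0 : 0 < w) (hw : w ≤ pcW M) (B : ℕ → ℝ)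
    (hB : ∀ i, |B i| ≤ M) (k j : ℕ) :
    HasDerivAt (fun t => vaU w x (update B k t) j) (vaDU w x B k j) (B k) := by
  unfold vaU vaDU
  have h := hasDerivAt_ahPhase_update (x := x) hM hw0 hw B hB k j
  have h2 := ((h.const_mul (2 * π)).cos).const_sub 1
  refine h2.congr_deriv ?_
  rw [update_eq_self]; ring

/-- `∂P_j/∂B_k` is the derivative of the section of `P_j`. [folklore] -/
theorem hasDerivAt_vaP_update (hM : 0 ≤ M) (hw0 : 0 < w) (hw : w ≤ pcW M) (B : ℕ → ℝ)
    (hB : ∀ i, |B i| ≤ M) (k j : ℕ) :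
    HasDerivAt (fun t => vaP w x (update B k t) j) (vaDP w x B k j) (B k) := by
  unfold vaP vaDP
  have hX := hasDerivAt_ahPhase_update (x := x) hM hw0 hw B hB k j
  rcases eq_or_ne j k with rfl | hjk
  · -- both arguments move: `X_j(B[j ↦ t])` is constant in `t`
    have hconst : ∀ t, ahPhase w x (update B j t) j = ahPhase w x B j :=
      fun t => ahPhase_update_of_le w x B le_rfl t
    have hfun : (fun t => pcP (ahPhase w x (update B j t) j) (igDelta w (update B j t j))) =
        fun t => pcP (ahPhase w x B j) (igC w * t) := by
      funext t; rw [hconst t, update_self]; rfl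
    rw [hfun]
    have hlin : HasDerivAt (fun t : ℝ => igC w * t) (igC w) (B j) := by
      simpa using (hasDerivAt_id (B j)).const_mul (igC w)
    have h := (hasDerivAt_pcP_delta (ahPhase w x B j) (igC w * B j)).comp (B j) hlin
    refine h.congr_deriv ?_
    simp [vaDX_of_le w x B le_rfl, igDelta]
  · have hfun : (fun t => pcP (ahPhase w x (update B k t) j) (igDelta w (update B k t j))) =
        fun t => pcP (ahPhase w x (update B k t) j) (igDelta w (B j)) := by
      funext t; rw [update_of_ne hjk]
    rw [hfun]
    have h := (hasDerivAt_pcP_x (ahPhase w x (update B k (B k)) j) (igDelta w (B j))).comp (B k) hX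
    rw [update_eq_self] at h
    refine h.congr_deriv ?_
    simp [hjk]

/-- `∂J_j/∂B_k` is the derivative of the section of `J_j`. [folklore] -/
theorem hasDerivAt_vaJ_update (hM : 0 ≤ M) (hw0 : 0 < w) (hw : w ≤ pcW M) (B : ℕ → ℝ)
    (hB : ∀ i, |B i| ≤ M) (k : ℕ) :
    ∀ j, HasDerivAt (fun t => vaJ w x (update B k t) j) (vaDJ w x B k j) (B k)
  | 0 => by simpa [vaJ, vaDJ] using hasDerivAt_const (B k) (1 : ℝ)
  | j + 1 => by
    have ih := hasDerivAt_vaJ_update hM hw0 hw B hB k j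
    have hP := hasDerivAt_vaP_update (x := x) hM hw0 hw B hB k j
    have hPpos : vaP w x (update B k (B k)) j ≠ 0 := by rw [update_eq_self]; exact (vaP_pos w x B j).ne'
    have hinv := hP.fun_inv hPpos
    have h := ih.mul hinv
    have hfun : (fun t => vaJ w x (update B k t) (j + 1)) =
        fun t => vaJ w x (update B k t) j * (vaP w x (update B k t) j)⁻¹ := by
      funext t; rw [vaJ_succ]
    rw [hfun]
    refine h.congr_deriv ?_
    simp only [vaDJ, update_eq_self]

/-- `∂N_j/∂B_k` is the derivative of the section of `N_j`, for `ξ ∈ C¹`. [folklore] -/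
theorem hasDerivAt_vaN_update (hM : 0 ≤ M) (hw0 : 0 < w) (hw : w ≤ pcW M) (B : ℕ → ℝ)
    (hB : ∀ i, |B i| ≤ M) {ξ : ℝ → ℝ} (hξ : Differentiable ℝ ξ) (k j : ℕ) :
    HasDerivAt (fun t => vaN w x (update B k t) ξ j) (vaDN w x B ξ k j) (B k) := by
  unfold vaN vaDN
  refine HasDerivAt.fun_sum fun i _ => ?_
  have hU := hasDerivAt_vaU_update (x := x) hM hw0 hw B hB k i
  rcases eq_or_ne i k with rfl | hik
  · have hξ' : HasDerivAt (fun t => ξ (update B i t i)) (deriv ξ (B i)) (B i) := by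
      simp only [update_self]; exact (hξ (B i)).hasDerivAt
    have h := hξ'.mul hU
    refine h.congr_deriv ?_
    simp only [↓reduceIte, update_self, update_eq_self]
  · have hfun : (fun t => ξ (update B k t i) * vaU w x (update B k t) i) =
        fun t => ξ (B i) * vaU w x (update B k t) i := by
      funext t; rw [update_of_ne hik]
    rw [hfun]
    refine (hU.const_mul (ξ (B i))).congr_deriv ?_
    simp only [hik, ↓reduceIte, zero_add]

end Derivatives

end Literature.Barriers.AtomisticToContinuum.HeatConduction

end
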